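import Summits.QuantumFields.YangMills.Theorems.BalabanUVNodesC44IterMhPlaqBridge
import Literature.MathematicalPhysics.QuantumFieldTheory.Balaban1983to89.B11Rem289KernelColumnsTheta3
import Literature.MathematicalPhysics.QuantumFieldTheory.Balaban1983to89.B11Eq88KernelColumnsComposite
import HarnessLib

/-!
# [B11] PROP. 4 AT THE RECORD — THE (ℓd) COLUMN LETTER `Prop4LetterColumnsAtRecord` REDUCED BY NAME TO THREE PRIMITIVE KERNEL LETTERS ((KL-H) the one-block
# letter of `H₁(U₀)`, (KL-N) the one-block letter of `Δπ∘H₁(U₀)`, (KL-C) the one-bond coarse-column letter of `D C^{𝔰𝔩}`) + (ℓa-H) + (ℓa-C) + the numbers,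
# over lit's THREE ABSTRACT KERNEL-COLUMN THEOREMS; and PROP. 4 AT THE RECORD IN THE NODE-00 REGIME FROM (ℓa-H) + (KL-H)(KL-N)(KL-C) + PRINT's (14)

Cell `pub-ymgap` ∕ `ym-nodeO-ideate`, porter lineage `ymgap-nodeO-port-PTB-1` (gen 8); ★★★ director-ym g22 №578 (2)(iii) («(ℓd) `Prop4LetterColumnsAtRecord … θ₃ θE θE′ N₁` =
(86)–(89) column bounds — PT-B's next L row»; ✦ plan g103: (R1)-row owner «unowned»); PORT-PLAN-v6 §G1.  `--kind proof --supports stmt-QuantumFields-27238 --as helper`;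
count-neutral.  [B11] = [Balaban1985Variational]; [B9] = [Balaban1985BackgroundPropagators]; [B7] = [Balaban1985Averaging].

THE PRINT ([B11] p.291): «⟨A′, Δ_π HD(A′)⟩ = ⟨A′, (Δ_U + DRD*)HD(A′)⟩ (87) … Applying the inequalities (3.132) from [5], (55), (73), and remembering that the symbol a above
represents the operator of multiplication by (Lʲη)⁻² … we can estimate this functional derivative by O(1)ε₁(Lʲη)⁻³ on Ω_j» (88); (73) p.289 «|𝔇(A′; c, b)| ≦ O(1)C₃ε₃(Lʲη)^{−d+1}
e^{−½δ₀d(c₋,y)}»; [B7] Prop. 5 (157) p.42 «|(δ∕δA_b)C_k(U₀, A, c)| ≦ C₃|A|».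

WHAT (ℓd) IS, LOCATED.  def-Y's DISPLAYED letter `Prop4LetterColumnsAtRecord … εC Gp R′ θ₃ θE θE′ N₁` (`Node00/BgSchemeOfRecordProp4`) = lit's `Prop4LetterColumns` at the record's
slots `H := H1OfRecordAtBgFlat …`, `C := CslOfRecord …`, `Δπ := DeltaPiCurOfRecord … Gp Q′♭`: the four binders `hN₁ hΘE hΘ′ hΘ3` of ✓`quadAnalytic_W80_composite`.  Lit PROVES the
three column binders GENERICALLY in `(H, C, N)` from PRIMITIVE KERNEL LETTERS — ✓`B11Eq73KernelColumnsCarrier.colSum_weighted_kernel_fderiv_Emap_le` (θ_E, (73) → (86)),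
✓`B11Rem289KernelColumnsTheta3.colSum_weighted_kernel_fderiv_E3_le` (θ₃, Schwarz to second order), ✓`B11Eq88KernelColumnsComposite.colSum_weighted_comp_fderiv_Emap_le` (θ_E′, the
composite (87)–(88)) — namely from: **(KL-H)** the ONE-BLOCK KERNEL LETTER of `H`: `‖(H δ_y Z)(b′)‖ ≤ hk(b′, y)‖Z‖` with fine-column sums `Σ_{b′} hk ≤ Θ_H` and (3)∕(3)-weighted sums
`≤ Θ_H^w` ([B9] (3.126)∕(3.132) — the (R1)-class letter, print's «(3.132) from [5]»); **(KL-N)** the one-block letter of `N∘H = Δπ∘H`: `hk′` with (3)∕(1)-weighted column sums `≤ Θ′`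
and (for `N₁`) the weighted ROW sums `Σ_y (w₃(b′)∕w_B(y))·hk′(b′, y) ≤ N₁` ((117)'s `|H|, |∇H|, |ΔH|` letters through the local stencil `Δ̃ − Q†aQ`; (R1)-class); **(KL-C)** the
ONE-BOND COARSE-COLUMN LETTER of `𝒞′ = DC`: `‖(DC(A)(X·δ_b))(y)‖ ≤ gC(y, b)‖A‖‖X‖`, `Σ_y gC(y, b) ≤ G` ([B7] Prop. 5 (157) for the record's averaging: `G ~ η^d`, forced by the
window `(ε_C + a_C)·Θ_H·G ≤ ½`); plus (ℓa-H) `‖H‖ ≤ b`, (ℓa-C) `Prop4Hyp C C₂ c₄`, the numbers `Prop4LetterNum …` (Sect. C regime) and `0 < a_C`.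
This file DOES the reduction (glue; `N₁` = a three-line row-sum bound proved here) — so the (ℓd) row reads, BY NAME: two (R1)-class kernel letters of the record's `H₁(U₀)` and ONE
[B7]-Prop.-5-class kernel letter of the record's nonlinear averaging remainder.

WHAT THIS FILE PROVES (0 def):
§1 (generic carriers, lit's binder shapes verbatim) `norm_comp_le_of_oneBlock_rowSum` (the `N₁` conjunct from (KL-N)'s row sums), ★★ `prop4LetterColumns_of_kernelLetters` :
   (ℓa-H) → (ℓa-C) → numbers → (KL-H) → (KL-C) → window → (KL-N) ⇒ `Prop4LetterColumns H C εC N R′ θ₃ θE θE′ N₁` with lit's closed terms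
   `θ_E = 2Θ_H^wGℓ`, `θ₃ = (2ℓ + 1)Θ_H^wG∕a_C`, `θ_E′ = 2Θ′Gℓ`, `ℓ = (1 − 4bC₂(ε_C + a_C))⁻¹`.
§2 (record) `prop4LetterColumns_record_of_kernelLetters` (the record's `H`, `C` slots, any current-valued reader `N` — settles the generic-vs-record instance bookkeeping once),
   ★★ `prop4LetterColumnsAtRecord_of_kernelLetters` — def-Y's letter itself: `Prop4LetterColumnsAtRecord F N K k Ω U₀ levB a hpos hQ εC Gp R′ θ₃ θE θE′ N₁`.
§3 (record, node-00 regime `Ω_j = T`, `0 < k`) ★★★ `prop4UniformAtRecord_node00_of_kernelLetters` — F8 ✓`prop4UniformAtRecord_node00_of_HCol_pos` ∘ §2 with (ℓa-C) := F6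
   ✓`prop4LetterCAtRecord_of_regular`, numbers := ✓`prop4LetterNum_explicit` at `ε_C = a_C = r`, `R_V = 1∕16`: PROP. 4 (97)–(98) AT THE RECORD from (ℓa-H) + (KL-H) + (KL-N) + (KL-C)
   (at the explicit k-free radius `r = min(c₄∕4, ½, (16(bC₂+1))⁻¹)`, `C₂ = 1.28·10¹⁶LN`, `c₄ = (2·10¹¹LN)⁻¹`) + print's (14) (`hreg` + `‖J‖ ≤ nJ`) — every constant a closed term in the
   letters.  The three kernel letters are DISPLAYED INLINE (def-Y∕DEF-1 own record letter names; no `def` here).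

HONEST FRAMING.  Glue over lit's kernel route and F6∕F7∕F8; NO estimate of [B9]∕[B11]∕[B7] is proved here.  OPEN, BY NAME, for Prop. 4 at the record (node-00): (ℓa-H) and (KL-H)(KL-N)
= [B9] Thm 3.12∕(3.126)∕(3.132) for the RECORD's `H₁(U₀)` ((R1)-class, XL, not PT-B's — №578 (2)(iv)); (KL-C) = [B7] Prop. 5 for the RECORD's (0.4) `exp[mean log]` averaging
(lit ✓`B7Prop5General.prop5_general_157` covers B7's corner-block ℤ^d model only; XL).  (ℓa-C) discharged ONLY for Ω_j = T; (R1)∕(R2) OPEN; K0ᴬ ⟨stmt-QuantumFields-27238⟩ NOT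
closed; K0ᴬ∕K1ᴬ∕K3ᴬ 0∕3; NODE O 0∕1; COUNT 8∕28 · K 1∕4 UNMOVED; finite `𝕋⁴_{L^K}` at fixed ε — NOT continuum ∕ ℝ⁴ ∕ OS; **the Yang–Mills mass gap (Clay) is NOT proved by any of
this.**  No `sorry`, `instance`, `notation`, `set_option`; standard axioms.
-/

noncomputable section

open scoped Matrix Matrix.Norms.L2Operator InnerProductSpace ComplexConjugate BigOperators

namespace Summit.QuantumFields.YangMills.Theorems.Prop4UniformAtRecord

open Literature.MathematicalPhysics.QuantumFieldTheory.Balaban1983to89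
open T4Continuum BlockAveraging
open B9SectCLatticeCarrier (Bond)
open B11Eq103H1Complex (SiteL2K)
open B11Eq111FrakG (nabla115)
open B11Eq115Space (NegSup NegSize Space115 levWeight levWeight_pos)
open B11Eq90Transpose (kernel single115)
open B11Eq90V0primeCurrent (flat115)
open B11Eq80Current (Emap E3)
open B11Eq174Chart (Regime)
open B11Prop6Scheme (Prop4Hyp)
open B11Eq73KernelColumnsCarrier (negSup_sum_single colSum_weighted_kernel_fderiv_Emap_le)
open B11Rem289KernelColumnsTheta3 (colSum_weighted_kernel_fderiv_E3_le)
open B11Eq88KernelColumnsComposite (colSum_weighted_comp_fderiv_Emap_le)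
open B11Eq118RegimeRadiiUniform (radius_pos)
open Node00
open Summit.QuantumFields.YangMills.Theorems.C44IterMh (prop4LetterCAtRecord_of_regular prop4UniformAtRecord_node00_of_HCol_pos)

/-! ## §1  Generic carriers: (ℓd) from the primitive kernel letters -/

section Generic

variable {𝔸 : Type*} [NormedRing 𝔸] [NormedAlgebra ℂ 𝔸] [FiniteDimensional ℂ 𝔸] [CompleteSpace 𝔸]
variable {d : ℕ} {Pd : Fin d → ℕ} {L η : ℝ} [Fact (0 < L)] [Fact (0 < η)] {lev₀ : Bond d Pd → ℕ} {κ' : Type*} [Fintype κ']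
  {lev₁ : κ' → ℕ} {Dc : (Bond d Pd → 𝔸) →ₗ[ℂ] (κ' → 𝔸)}
variable {β : Type*} [Fintype β] [DecidableEq β] {wB : β → ℝ} [Fact (∀ y, 0 < wB y)]

omit [FiniteDimensional ℂ 𝔸] [CompleteSpace 𝔸] in
/-- **THE `N₁` CONJUNCT FROM (KL-N)'s ROW SUMS**: if `‖(N(H δ_y Z))(b′)‖ ≤ hk′(b′, y)‖Z‖` and `Σ_y (w₃(b′)∕w_B(y))·hk′(b′, y) ≤ N₁` for every fine `b′`, then
`‖N(HX)‖₍₋₃₎ ≤ N₁‖X‖_{w_B}` (decompose `X = Σ_y δ_y X(y)`, weighted sup). [cite: Balaban1985Variational, (85) p.291, (88) p.291, (117) p.295] -/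
theorem norm_comp_le_of_oneBlock_rowSum (H : NegSup wB 𝔸 →L[ℂ] Space115 L η lev₀ lev₁ Dc) (N : Space115 L η lev₀ lev₁ Dc →L[ℂ] NegSize L η lev₀ 3 𝔸)
    {hk' : Bond d Pd → β → ℝ} (hk'0 : ∀ b' y, 0 ≤ hk' b' y)
    (hNk : ∀ (y : β) (Z : 𝔸) (b' : Bond d Pd), ‖NegSup.equiv (levWeight L η lev₀ 3) 𝔸 (N (H ((NegSup.equiv wB 𝔸).symm (Pi.single y Z)))) b'‖ ≤ hk' b' y * ‖Z‖)
    {N₁ : ℝ} (hN₁0 : 0 ≤ N₁) (hN₁ : ∀ b', ∑ y, levWeight L η lev₀ 3 b' / wB y * hk' b' y ≤ N₁) (X : NegSup wB 𝔸) :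
    ‖N (H X)‖ ≤ N₁ * ‖X‖ := by
  have hw3 : ∀ b' : Bond d Pd, 0 < levWeight L η lev₀ 3 b' := levWeight_pos (Fact.out : 0 < L) (Fact.out : 0 < η) lev₀ 3
  rw [NegSup.norm_le_iff (by positivity)]
  intro b'
  have hdec : NegSup.equiv (levWeight L η lev₀ 3) 𝔸 (N (H X)) b' =
      ∑ y, NegSup.equiv (levWeight L η lev₀ 3) 𝔸 (N (H ((NegSup.equiv wB 𝔸).symm (Pi.single y (NegSup.equiv wB 𝔸 X y))))) b' := by
    conv_lhs => rw [← negSup_sum_single X]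
    rw [map_sum, map_sum, ← NegSup.evalCLM_apply (𝕜 := ℂ), map_sum]
    simp only [NegSup.evalCLM_apply]
  rw [hdec]
  calc levWeight L η lev₀ 3 b' * ‖∑ y, NegSup.equiv (levWeight L η lev₀ 3) 𝔸 (N (H ((NegSup.equiv wB 𝔸).symm (Pi.single y (NegSup.equiv wB 𝔸 X y))))) b'‖
      ≤ levWeight L η lev₀ 3 b' * ∑ y, hk' b' y * ((wB y)⁻¹ * ‖X‖) := by
        refine mul_le_mul_of_nonneg_left ((norm_sum_le _ _).trans (Finset.sum_le_sum fun y _ => ?_)) (hw3 b').le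
        exact (hNk y _ b').trans (mul_le_mul_of_nonneg_left (NegSup.norm_apply_le X y) (hk'0 b' y))
    _ = (∑ y, levWeight L η lev₀ 3 b' / wB y * hk' b' y) * ‖X‖ := by
        rw [Finset.mul_sum, Finset.sum_mul]
        refine Finset.sum_congr rfl fun y _ => ?_
        rw [div_eq_mul_inv]; ring
    _ ≤ N₁ * ‖X‖ := mul_le_mul_of_nonneg_right (hN₁ b') (norm_nonneg _)

/-- ★★ **(ℓd) FROM THE PRIMITIVE KERNEL LETTERS** — `Prop4LetterColumns H C ε_C N R′ θ₃ θ_E θ_E′ N₁` with lit's closed terms `θ_E = 2Θ_H^wGℓ`, `θ₃ = (2ℓ + 1)Θ_H^wG∕a_C`,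
`θ_E′ = 2Θ′Gℓ`, `ℓ = (1 − 4bC₂(ε_C + a_C))⁻¹`, from: (ℓa-H) `‖H‖ ≤ b`, (ℓa-C) `Prop4Hyp C C₂ c₄`, the numbers `Prop4LetterNum b C₂ c₄ a_C ε_C R_V R′` (⇒ the Sect. C regime,
`R′ ≤ a_C`) and `0 < a_C`; (KL-H) the one-block letter `hk` of `H` with its plain and (3)∕(3)-weighted fine-column sums `Θ_H, Θ_H^w`; (KL-C) the one-bond coarse-column letter
`gC` of `DC` with `Σ_y gC ≤ G`; the window `(ε_C + a_C)Θ_HG ≤ ½`; (KL-N) the one-block letter `hk′` of `N∘H` with (3)∕(1)-weighted column sums `Θ′` and weighted row sums `N₁`.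
The three column conjuncts are lit's ✓`colSum_weighted_kernel_fderiv_Emap_le`, ✓`colSum_weighted_comp_fderiv_Emap_le`, ✓`colSum_weighted_kernel_fderiv_E3_le` VERBATIM on `‖A′‖ < R′ ≤ a_C`.
[cite: Balaban1985Variational, (86)–(89) p.291, (73) p.289, (55) p.286, Prop. 4 (97)–(98) pp.292–293; Balaban1985BackgroundPropagators, (3.132) p.422; Balaban1985Averaging, Proposition 5 (157) p.42] -/
theorem prop4LetterColumns_of_kernelLetters {H : NegSup wB 𝔸 →L[ℂ] Space115 L η lev₀ lev₁ Dc} {C : Space115 L η lev₀ lev₁ Dc → NegSup wB 𝔸}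
    {b C₂ c₄ aC εC RV R' : ℝ} (hH : Prop4LetterH H b) (hC : Prop4Hyp C C₂ c₄) (hnum : Prop4LetterNum b C₂ c₄ aC εC RV R') (haC : 0 < aC)
    {hk : Bond d Pd → β → ℝ} (hk0 : ∀ b' y, 0 ≤ hk b' y)
    (hHk : ∀ (y : β) (Z : 𝔸) (b' : Bond d Pd), ‖flat115 (H ((NegSup.equiv wB 𝔸).symm (Pi.single y Z))) b'‖ ≤ hk b' y * ‖Z‖)
    {ΘH : ℝ} (hΘH : 0 ≤ ΘH) (hH1 : ∀ y, ∑ b', hk b' y ≤ ΘH) {ΘHw : ℝ} (hΘHw : 0 ≤ ΘHw)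
    (hHw : ∀ (bb : Bond d Pd) (y : β), ∑ b', levWeight L η lev₀ 3 bb / levWeight L η lev₀ 3 b' * hk b' y ≤ ΘHw)
    {gC : β → Bond d Pd → ℝ} (hgC0 : ∀ y bb, 0 ≤ gC y bb)
    (hCg : ∀ A : Space115 L η lev₀ lev₁ Dc, ‖A‖ < εC + aC → ∀ (bb : Bond d Pd) (X : 𝔸) (y : β),
      ‖NegSup.equiv wB 𝔸 (fderiv ℂ C A (single115 (lev₁ := lev₁) (Dc := Dc) bb X)) y‖ ≤ gC y bb * ‖A‖ * ‖X‖)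
    {G : ℝ} (hG0 : 0 ≤ G) (hG : ∀ bb, ∑ y, gC y bb ≤ G) (hq : (εC + aC) * ΘH * G ≤ 1 / 2)
    (N : Space115 L η lev₀ lev₁ Dc →L[ℂ] NegSize L η lev₀ 3 𝔸)
    {hk' : Bond d Pd → β → ℝ} (hk'0 : ∀ b' y, 0 ≤ hk' b' y)
    (hNk : ∀ (y : β) (Z : 𝔸) (b' : Bond d Pd), ‖NegSup.equiv (levWeight L η lev₀ 3) 𝔸 (N (H ((NegSup.equiv wB 𝔸).symm (Pi.single y Z)))) b'‖ ≤ hk' b' y * ‖Z‖)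
    {Θ' : ℝ} (hΘ'0 : 0 ≤ Θ') (hΘ' : ∀ (bb : Bond d Pd) (y : β), ∑ b', levWeight L η lev₀ 3 bb / levWeight L η lev₀ 1 b' * hk' b' y ≤ Θ')
    {N₁ : ℝ} (hN₁0 : 0 ≤ N₁) (hN₁ : ∀ b', ∑ y, levWeight L η lev₀ 3 b' / wB y * hk' b' y ≤ N₁) :
    Prop4LetterColumns H C εC N R'
      ((2 * (1 / (1 - 4 * b * C₂ * (εC + aC))) + 1) * ΘHw * G / aC)
      (2 * ΘHw * G * (1 / (1 - 4 * b * C₂ * (εC + aC))))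
      (2 * Θ' * G * (1 / (1 - 4 * b * C₂ * (εC + aC)))) N₁ := by
  have RC : Regime H (0 : Space115 L η lev₀ lev₁ Dc →L[ℂ] Space115 L η lev₀ lev₁ Dc) C b 0 C₂ c₄ 0 aC εC := regimeC_of_letters hH hC hnum
  obtain ⟨-, -, -, -, -, hcontr, -, hR'a, -⟩ := hnum
  have hℓ : 0 ≤ 1 / (1 - 4 * b * C₂ * (εC + aC)) := by
    have : 0 < 1 - 4 * b * C₂ * (εC + aC) := by linarith
    positivity
  refine ⟨⟨?_, ?_, ?_, hN₁0⟩, fun X => norm_comp_le_of_oneBlock_rowSum H N hk'0 hNk hN₁0 hN₁ X, fun A' hA' bb => ?_, fun A' hA' bb X => ?_, fun A' hA' bb => ?_⟩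
  · have : 0 ≤ (2 * (1 / (1 - 4 * b * C₂ * (εC + aC))) + 1) := by positivity
    positivity
  · positivity
  · positivity
  · exact (colSum_weighted_kernel_fderiv_Emap_le RC hC hk0 hHk hH1 hgC0 hCg hG hq hΘH hΘHw hHw (hA'.trans_le hR'a) bb)
  · exact (colSum_weighted_comp_fderiv_Emap_le RC hC hk0 hHk hH1 hgC0 hCg hG hq N hk'0 hNk hΘH bb
      (r := fun b' => levWeight L η lev₀ 3 bb / levWeight L η lev₀ 1 b')
      (fun b' => div_nonneg (levWeight_pos (Fact.out : 0 < L) (Fact.out : 0 < η) lev₀ 3 bb).le (levWeight_pos (Fact.out : 0 < L) (Fact.out : 0 < η) lev₀ 1 b').le)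
      hΘ'0 (hΘ' bb) (hA'.trans_le hR'a) X)
  · exact (colSum_weighted_kernel_fderiv_E3_le RC hC haC hk0 hHk hΘH hH1 hΘHw hHw hgC0 hCg hG hq (hA'.trans_le hR'a) bb)

end Generic

/-! ## §2  At the record: (ℓd) `Prop4LetterColumnsAtRecord` from the three kernel letters of the record's `H₁(U₀)`, `Δπ∘H₁(U₀)`, `D C^{𝔰𝔩}` -/

section Record

variable (F : T4Family) (N : ℕ) [NeZero N] (K k : ℕ) (Ω : ℕ → Set (Site (F.P K) 0)) (U₀ : GaugeField (F.P K) 0 (SU N))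
variable [Fact (0 < (F.L : ℝ))] [Fact (0 < (F.P K).eta k)] [Fact (0 < c0Rec F K k)] [Fact (∀ c, 0 < wBRec F K k c)]

/-- ★ **(ℓd)'s SHAPE AT THE RECORD's `H`, `C` SLOTS FOR ANY CURRENT-VALUED READER `N`** (`H := H1OfRecordAtBgFlat …`, `C := CslOfRecord …`, `N : 𝒴 →L |·|₍₋₃₎` free): §1 with the
record's (ℓa-H)∕(ℓa-C) letters by name.  (Stated with `N` free so that the generic-vs-record instance bookkeeping is settled once, here.)
[cite: Balaban1985Variational, (86)–(89) p.291, Prop. 4 (97)–(98) pp.292–293] -/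
theorem prop4LetterColumns_record_of_kernelLetters [DecidableEq (PBond (F.P K) k)] (levB : PBond (F.P K) k → ℕ) (a : ℝ)
    (Ncur : Space115Lit F N K k Ω U₀ →L[ℂ] NegSizeLit F N K k Ω 3)
    (hpos : ∀ x, x ≠ 0 → 0 < RCLike.re ⟪x, laplaceAOfRecord F N k U₀ (QOfRecord F N k U₀) (QflatOfRecord F N k) a x⟫_ℂ)
    (hQ : Function.Surjective (QOfRecord F N k U₀))
    {b C₂ c₄ aC εC RV R' : ℝ} (hH : Prop4LetterHAtRecord F N K k Ω U₀ levB a hpos hQ b) (hC : Prop4LetterCAtRecord F N K k Ω U₀ levB C₂ c₄)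
    (hnum : Prop4LetterNum b C₂ c₄ aC εC RV R') (haC : 0 < aC)
    -- (KL-H) the one-block kernel letter of `H₁(U₀)` of record, with plain and (3)/(3)-weighted fine-column sums
    {hk : Bond (F.P K).d (fun _ => (F.P K).sitesPerDir 0) → PBond (F.P K) k → ℝ} (hk0 : ∀ b' y, 0 ≤ hk b' y)
    (hHk : ∀ (y : PBond (F.P K) k) (Z : Matrix (Fin N) (Fin N) ℂ) (b' : Bond (F.P K).d (fun _ => (F.P K).sitesPerDir 0)),
      ‖flat115 (H1OfRecordAtBgFlat F N K k Ω U₀ levB a hpos hQ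
          ((NegSup.equiv (levWeight (F.L : ℝ) ((F.P K).eta k) levB 0) (Matrix (Fin N) (Fin N) ℂ)).symm (Pi.single y Z))) b'‖ ≤ hk b' y * ‖Z‖)
    {ΘH : ℝ} (hΘH : 0 ≤ ΘH) (hH1 : ∀ y, ∑ b', hk b' y ≤ ΘH) {ΘHw : ℝ} (hΘHw : 0 ≤ ΘHw)
    (hHw : ∀ (bb : Bond (F.P K).d (fun _ => (F.P K).sitesPerDir 0)) (y : PBond (F.P K) k),
      ∑ b', levWeight (F.L : ℝ) ((F.P K).eta k) (bondLevLit F Ω k) 3 bb / levWeight (F.L : ℝ) ((F.P K).eta k) (bondLevLit F Ω k) 3 b' * hk b' y ≤ ΘHw)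
    -- (KL-C) the one-bond coarse-column letter of `D C^{sl}` of record, and the window
    {gC : PBond (F.P K) k → Bond (F.P K).d (fun _ => (F.P K).sitesPerDir 0) → ℝ} (hgC0 : ∀ y bb, 0 ≤ gC y bb)
    (hCg : ∀ A : Space115Lit F N K k Ω U₀, ‖A‖ < εC + aC → ∀ (bb : Bond (F.P K).d (fun _ => (F.P K).sitesPerDir 0)) (X : Matrix (Fin N) (Fin N) ℂ)
      (y : PBond (F.P K) k), ‖NegSup.equiv (levWeight (F.L : ℝ) ((F.P K).eta k) levB 0) (Matrix (Fin N) (Fin N) ℂ)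
        (fderiv ℂ (CslOfRecord F N K k Ω U₀ levB) A
          (single115 (lev₁ := pairLevLit F Ω k) (Dc := nabla115 ((F.P K).eta k) (unitsOfRecord F N U₀)) bb X)) y‖ ≤ gC y bb * ‖A‖ * ‖X‖)
    {G : ℝ} (hG0 : 0 ≤ G) (hG : ∀ bb, ∑ y, gC y bb ≤ G) (hq : (εC + aC) * ΘH * G ≤ 1 / 2)
    -- (KL-N) the one-block letter of `Δπ∘H₁(U₀)` of record, with (3)/(1)-weighted column sums and weighted row sums
    {hk' : Bond (F.P K).d (fun _ => (F.P K).sitesPerDir 0) → PBond (F.P K) k → ℝ} (hk'0 : ∀ b' y, 0 ≤ hk' b' y)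
    (hNk : ∀ (y : PBond (F.P K) k) (Z : Matrix (Fin N) (Fin N) ℂ) (b' : Bond (F.P K).d (fun _ => (F.P K).sitesPerDir 0)),
      ‖NegSup.equiv (levWeight (F.L : ℝ) ((F.P K).eta k) (bondLevLit F Ω k) 3) (Matrix (Fin N) (Fin N) ℂ)
        (Ncur (H1OfRecordAtBgFlat F N K k Ω U₀ levB a hpos hQ
          ((NegSup.equiv (levWeight (F.L : ℝ) ((F.P K).eta k) levB 0) (Matrix (Fin N) (Fin N) ℂ)).symm (Pi.single y Z)))) b'‖ ≤ hk' b' y * ‖Z‖)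
    {Θ' : ℝ} (hΘ'0 : 0 ≤ Θ')
    (hΘ' : ∀ (bb : Bond (F.P K).d (fun _ => (F.P K).sitesPerDir 0)) (y : PBond (F.P K) k),
      ∑ b', levWeight (F.L : ℝ) ((F.P K).eta k) (bondLevLit F Ω k) 3 bb / levWeight (F.L : ℝ) ((F.P K).eta k) (bondLevLit F Ω k) 1 b' * hk' b' y ≤ Θ')
    {N₁ : ℝ} (hN₁0 : 0 ≤ N₁)
    (hN₁ : ∀ b', ∑ y, levWeight (F.L : ℝ) ((F.P K).eta k) (bondLevLit F Ω k) 3 b' / levWeight (F.L : ℝ) ((F.P K).eta k) levB 0 y * hk' b' y ≤ N₁) :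
    Prop4LetterColumns (H1OfRecordAtBgFlat F N K k Ω U₀ levB a hpos hQ) (CslOfRecord F N K k Ω U₀ levB) εC Ncur R'
      ((2 * (1 / (1 - 4 * b * C₂ * (εC + aC))) + 1) * ΘHw * G / aC)
      (2 * ΘHw * G * (1 / (1 - 4 * b * C₂ * (εC + aC))))
      (2 * Θ' * G * (1 / (1 - 4 * b * C₂ * (εC + aC)))) N₁ :=
  by
  unfold Prop4LetterHAtRecord at hH
  unfold Prop4LetterCAtRecord at hC
  exact prop4LetterColumns_of_kernelLetters hH hC hnum haC hk0 hHk hΘH hH1 hΘHw hHw hgC0 hCg hG0 hG hq Ncur hk'0 hNk hΘ'0 hΘ' hN₁0 hN₁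

/-- ★★ **(ℓd) AT THE RECORD FROM THE THREE PRIMITIVE KERNEL LETTERS** — def-Y's displayed `Prop4LetterColumnsAtRecord … εC Gp R′ θ₃ θE θE′ N₁` ((86)–(89) for
`H := H1OfRecordAtBgFlat …`, `C := CslOfRecord …`, `Δπ := DeltaPiCurOfRecord … Gp Q′♭`) holds, with lit's closed `θ`'s, as soon as (ℓa-H), (ℓa-C), the numbers, and the kernel letters
(KL-H) (one-block letter `hk` of the record's `H₁(U₀)`: [B9] (3.126)∕(3.132)), (KL-C) (one-bond coarse-column letter `gC` of `D(CslOfRecord)`: [B7] Prop. 5 (157)) with the window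
`(ε_C + a_C)Θ_HG ≤ ½`, and (KL-N) (one-block letter `hk′` of `Δπ∘H₁(U₀)`) are supplied — §1 at the record's slots.  The letters are DISPLAYED binders (inline, lit's shapes).
[cite: Balaban1985Variational, (86)–(89) p.291, (73) p.289, Prop. 4 (97)–(98) pp.292–293; Balaban1985BackgroundPropagators, (3.126) p.420, (3.132) p.422; Balaban1985Averaging, Proposition 5 (157) p.42] -/
theorem prop4LetterColumnsAtRecord_of_kernelLetters [DecidableEq (PBond (F.P K) k)] (levB : PBond (F.P K) k → ℕ) (a : ℝ)
    (hpos : ∀ x, x ≠ 0 → 0 < RCLike.re ⟪x, laplaceAOfRecord F N k U₀ (QOfRecord F N k U₀) (QflatOfRecord F N k) a x⟫_ℂ)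
    (hQ : Function.Surjective (QOfRecord F N k U₀))
    (Gp : SiteL2K ℂ (F.P K).d (fun _ => (F.P K).sitesPerDir 0) (c0Rec F K k) (WRec N) →ₗ[ℂ]
      SiteL2K ℂ (F.P K).d (fun _ => (F.P K).sitesPerDir 0) (c0Rec F K k) (WRec N))
    {b C₂ c₄ aC εC RV R' : ℝ} (hH : Prop4LetterHAtRecord F N K k Ω U₀ levB a hpos hQ b) (hC : Prop4LetterCAtRecord F N K k Ω U₀ levB C₂ c₄)
    (hnum : Prop4LetterNum b C₂ c₄ aC εC RV R') (haC : 0 < aC)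
    -- (KL-H) the one-block kernel letter of `H₁(U₀)` of record, with plain and (3)/(3)-weighted fine-column sums
    {hk : Bond (F.P K).d (fun _ => (F.P K).sitesPerDir 0) → PBond (F.P K) k → ℝ} (hk0 : ∀ b' y, 0 ≤ hk b' y)
    (hHk : ∀ (y : PBond (F.P K) k) (Z : Matrix (Fin N) (Fin N) ℂ) (b' : Bond (F.P K).d (fun _ => (F.P K).sitesPerDir 0)),
      ‖flat115 (H1OfRecordAtBgFlat F N K k Ω U₀ levB a hpos hQ
          ((NegSup.equiv (levWeight (F.L : ℝ) ((F.P K).eta k) levB 0) (Matrix (Fin N) (Fin N) ℂ)).symm (Pi.single y Z))) b'‖ ≤ hk b' y * ‖Z‖)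
    {ΘH : ℝ} (hΘH : 0 ≤ ΘH) (hH1 : ∀ y, ∑ b', hk b' y ≤ ΘH) {ΘHw : ℝ} (hΘHw : 0 ≤ ΘHw)
    (hHw : ∀ (bb : Bond (F.P K).d (fun _ => (F.P K).sitesPerDir 0)) (y : PBond (F.P K) k),
      ∑ b', levWeight (F.L : ℝ) ((F.P K).eta k) (bondLevLit F Ω k) 3 bb / levWeight (F.L : ℝ) ((F.P K).eta k) (bondLevLit F Ω k) 3 b' * hk b' y ≤ ΘHw)
    -- (KL-C) the one-bond coarse-column letter of `D C^{sl}` of record, and the window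
    {gC : PBond (F.P K) k → Bond (F.P K).d (fun _ => (F.P K).sitesPerDir 0) → ℝ} (hgC0 : ∀ y bb, 0 ≤ gC y bb)
    (hCg : ∀ A : Space115Lit F N K k Ω U₀, ‖A‖ < εC + aC → ∀ (bb : Bond (F.P K).d (fun _ => (F.P K).sitesPerDir 0)) (X : Matrix (Fin N) (Fin N) ℂ)
      (y : PBond (F.P K) k), ‖NegSup.equiv (levWeight (F.L : ℝ) ((F.P K).eta k) levB 0) (Matrix (Fin N) (Fin N) ℂ)
        (fderiv ℂ (CslOfRecord F N K k Ω U₀ levB) A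
          (single115 (lev₁ := pairLevLit F Ω k) (Dc := nabla115 ((F.P K).eta k) (unitsOfRecord F N U₀)) bb X)) y‖ ≤ gC y bb * ‖A‖ * ‖X‖)
    {G : ℝ} (hG0 : 0 ≤ G) (hG : ∀ bb, ∑ y, gC y bb ≤ G) (hq : (εC + aC) * ΘH * G ≤ 1 / 2)
    -- (KL-N) the one-block letter of `Δπ∘H₁(U₀)` of record, with (3)/(1)-weighted column sums and weighted row sums
    {hk' : Bond (F.P K).d (fun _ => (F.P K).sitesPerDir 0) → PBond (F.P K) k → ℝ} (hk'0 : ∀ b' y, 0 ≤ hk' b' y)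
    (hNk : ∀ (y : PBond (F.P K) k) (Z : Matrix (Fin N) (Fin N) ℂ) (b' : Bond (F.P K).d (fun _ => (F.P K).sitesPerDir 0)),
      ‖NegSup.equiv (levWeight (F.L : ℝ) ((F.P K).eta k) (bondLevLit F Ω k) 3) (Matrix (Fin N) (Fin N) ℂ)
        (DeltaPiCurOfRecord F N K k Ω U₀ Gp (QflatOfRecord F N k) (H1OfRecordAtBgFlat F N K k Ω U₀ levB a hpos hQ
          ((NegSup.equiv (levWeight (F.L : ℝ) ((F.P K).eta k) levB 0) (Matrix (Fin N) (Fin N) ℂ)).symm (Pi.single y Z)))) b'‖ ≤ hk' b' y * ‖Z‖)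
    {Θ' : ℝ} (hΘ'0 : 0 ≤ Θ')
    (hΘ' : ∀ (bb : Bond (F.P K).d (fun _ => (F.P K).sitesPerDir 0)) (y : PBond (F.P K) k),
      ∑ b', levWeight (F.L : ℝ) ((F.P K).eta k) (bondLevLit F Ω k) 3 bb / levWeight (F.L : ℝ) ((F.P K).eta k) (bondLevLit F Ω k) 1 b' * hk' b' y ≤ Θ')
    {N₁ : ℝ} (hN₁0 : 0 ≤ N₁)
    (hN₁ : ∀ b', ∑ y, levWeight (F.L : ℝ) ((F.P K).eta k) (bondLevLit F Ω k) 3 b' / levWeight (F.L : ℝ) ((F.P K).eta k) levB 0 y * hk' b' y ≤ N₁) :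
    Prop4LetterColumnsAtRecord F N K k Ω U₀ levB a hpos hQ εC Gp R'
      ((2 * (1 / (1 - 4 * b * C₂ * (εC + aC))) + 1) * ΘHw * G / aC)
      (2 * ΘHw * G * (1 / (1 - 4 * b * C₂ * (εC + aC))))
      (2 * Θ' * G * (1 / (1 - 4 * b * C₂ * (εC + aC)))) N₁ :=
  by
  unfold Prop4LetterColumnsAtRecord
  exact prop4LetterColumns_record_of_kernelLetters F N K k Ω U₀ levB a (DeltaPiCurOfRecord F N K k Ω U₀ Gp (QflatOfRecord F N k)) hpos hQ
    hH hC hnum haC hk0 hHk hΘH hH1 hΘHw hHw hgC0 hCg hG0 hG hq hk'0 hNk hΘ'0 hΘ' hN₁0 hN₁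

/-! ## §3  Node-00 regime (`Ω_j = T`, `0 < k`): PROP. 4 AT THE RECORD from (ℓa-H) + (KL-H) + (KL-N) + (KL-C) + print's (14) -/

/-- ★★★ **[B11] PROP. 4 (97)–(98) AT THE RECORD IN THE NODE-00 REGIME, REDUCED BY NAME TO (ℓa-H) + THE THREE PRIMITIVE KERNEL LETTERS + PRINT's (14).**  For `0 < k` and
every site in `Ω_k`: GIVEN (ℓa-H) `Prop4LetterHAtRecord … b`, the one-block kernel letter (KL-H) of the record's `H₁(U₀)` (`hk`, fine-column sums `Θ_H`, (3)∕(3)-weighted `Θ_H^w`;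
[B9] (3.126)∕(3.132)), the one-block letter (KL-N) of `Δπ∘H₁(U₀)` (`hk′`, (3)∕(1)-weighted columns `Θ′`, weighted rows `N₁`), the one-bond coarse-column letter (KL-C) of
`D(CslOfRecord)` on `‖A‖ < 2r` (`gC`, `Σ_y gC ≤ G`; [B7] Prop. 5 (157)) with the window `2r·Θ_H·G ≤ ½`, print's (14) at all scales `j < k` (`hreg`) and `‖J‖ ≤ nJ` — THEN
`Prop4UniformAtRecord … r Gp C₄ R′` at the explicit k-free radii `r = min(c₄∕4, ½, (16(bC₂+1))⁻¹)`, `R′ = min(r, (1 − 8bC₂r)∕16)` (`C₂ = 1.28·10¹⁶LN`, `c₄ = (2·10¹¹LN)⁻¹`) with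
`θ_E = 2Θ_H^wGℓ`, `θ₃ = (2ℓ + 1)Θ_H^wG∕r`, `θ_E′ = 2Θ′Gℓ`, `ℓ = (1 − 8bC₂r)⁻¹` inside F7's polynomial `C₄` — every constant a closed term in `L, N, b, α, Θ_H^w, Θ′, G, N₁, nJ`.
F8 ✓`prop4UniformAtRecord_node00_of_HCol_pos` ∘ §2 with (ℓa-C) := F6 ✓`prop4LetterCAtRecord_of_regular`, numbers := ✓`prop4LetterNum_explicit` (`ε_C = a_C = r`, `R_V = 1∕16`).
HONEST: glue; (ℓa-H), (KL-H), (KL-N) are (R1)-class and (KL-C) is [B7]-Prop.-5-class — DISPLAYED, not proved; constants crude.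
[cite: Balaban1985Variational, Prop. 4 (97)–(98) pp.292–293, (14) p.280, (44)–(46) p.285, (73) p.289, (86)–(89) p.291; Balaban1985BackgroundPropagators, (3.132) p.422; Balaban1985Averaging, Proposition 5 (157) p.42] -/
theorem prop4UniformAtRecord_node00_of_kernelLetters [DecidableEq (PBond (F.P K) k)] (levB : PBond (F.P K) k → ℕ) (a : ℝ)
    (hpos : ∀ x, x ≠ 0 → 0 < RCLike.re ⟪x, laplaceAOfRecord F N k U₀ (QOfRecord F N k U₀) (QflatOfRecord F N k) a x⟫_ℂ)
    (hQ : Function.Surjective (QOfRecord F N k U₀))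
    (Gp : SiteL2K ℂ (F.P K).d (fun _ => (F.P K).sitesPerDir 0) (c0Rec F K k) (WRec N) →ₗ[ℂ]
      SiteL2K ℂ (F.P K).d (fun _ => (F.P K).sitesPerDir 0) (c0Rec F K k) (WRec N))
    {b α nJ : ℝ} (hkpos : 0 < k) (hb : 0 ≤ b) (hΩ : ∀ x, x ∈ Ω k) (hα0 : 0 ≤ α) (hα : α * (11000000 * N) ≤ 1)
    (hreg : ∀ j, j < k → PlaqSmall (α * ((F.L : ℝ) ^ j * (F.P K).eta k) ^ 2) (Averaging.iter (avOfRecord F N K) j U₀))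
    (hH : Prop4LetterHAtRecord F N K k Ω U₀ levB a hpos hQ b)
    -- (KL-H)
    {hk : Bond (F.P K).d (fun _ => (F.P K).sitesPerDir 0) → PBond (F.P K) k → ℝ} (hk0 : ∀ b' y, 0 ≤ hk b' y)
    (hHk : ∀ (y : PBond (F.P K) k) (Z : Matrix (Fin N) (Fin N) ℂ) (b' : Bond (F.P K).d (fun _ => (F.P K).sitesPerDir 0)),
      ‖flat115 (H1OfRecordAtBgFlat F N K k Ω U₀ levB a hpos hQ
          ((NegSup.equiv (levWeight (F.L : ℝ) ((F.P K).eta k) levB 0) (Matrix (Fin N) (Fin N) ℂ)).symm (Pi.single y Z))) b'‖ ≤ hk b' y * ‖Z‖)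
    {ΘH : ℝ} (hΘH : 0 ≤ ΘH) (hH1 : ∀ y, ∑ b', hk b' y ≤ ΘH) {ΘHw : ℝ} (hΘHw : 0 ≤ ΘHw)
    (hHw : ∀ (bb : Bond (F.P K).d (fun _ => (F.P K).sitesPerDir 0)) (y : PBond (F.P K) k),
      ∑ b', levWeight (F.L : ℝ) ((F.P K).eta k) (bondLevLit F Ω k) 3 bb / levWeight (F.L : ℝ) ((F.P K).eta k) (bondLevLit F Ω k) 3 b' * hk b' y ≤ ΘHw)
    -- (KL-C) on `‖A‖ < 2r` and the window `2r·Θ_H·G ≤ ½`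
    {gC : PBond (F.P K) k → Bond (F.P K).d (fun _ => (F.P K).sitesPerDir 0) → ℝ} (hgC0 : ∀ y bb, 0 ≤ gC y bb)
    (hCg : letI C₂ : ℝ := 12800000000000000 * (F.L : ℝ) * N
      letI c₄ : ℝ := 1 / (200000000000 * (F.L : ℝ) * N)
      letI r : ℝ := min (c₄ / 4) (min (1 / 2) (1 / (16 * (b * C₂ + 1))))
      ∀ A : Space115Lit F N K k Ω U₀, ‖A‖ < r + r → ∀ (bb : Bond (F.P K).d (fun _ => (F.P K).sitesPerDir 0)) (X : Matrix (Fin N) (Fin N) ℂ)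
      (y : PBond (F.P K) k), ‖NegSup.equiv (levWeight (F.L : ℝ) ((F.P K).eta k) levB 0) (Matrix (Fin N) (Fin N) ℂ)
        (fderiv ℂ (CslOfRecord F N K k Ω U₀ levB) A
          (single115 (lev₁ := pairLevLit F Ω k) (Dc := nabla115 ((F.P K).eta k) (unitsOfRecord F N U₀)) bb X)) y‖ ≤ gC y bb * ‖A‖ * ‖X‖)
    {G : ℝ} (hG0 : 0 ≤ G) (hG : ∀ bb, ∑ y, gC y bb ≤ G)
    (hq : letI C₂ : ℝ := 12800000000000000 * (F.L : ℝ) * N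
      letI c₄ : ℝ := 1 / (200000000000 * (F.L : ℝ) * N)
      letI r : ℝ := min (c₄ / 4) (min (1 / 2) (1 / (16 * (b * C₂ + 1))))
      (r + r) * ΘH * G ≤ 1 / 2)
    -- (KL-N)
    {hk' : Bond (F.P K).d (fun _ => (F.P K).sitesPerDir 0) → PBond (F.P K) k → ℝ} (hk'0 : ∀ b' y, 0 ≤ hk' b' y)
    (hNk : ∀ (y : PBond (F.P K) k) (Z : Matrix (Fin N) (Fin N) ℂ) (b' : Bond (F.P K).d (fun _ => (F.P K).sitesPerDir 0)),
      ‖NegSup.equiv (levWeight (F.L : ℝ) ((F.P K).eta k) (bondLevLit F Ω k) 3) (Matrix (Fin N) (Fin N) ℂ)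
        (DeltaPiCurOfRecord F N K k Ω U₀ Gp (QflatOfRecord F N k) (H1OfRecordAtBgFlat F N K k Ω U₀ levB a hpos hQ
          ((NegSup.equiv (levWeight (F.L : ℝ) ((F.P K).eta k) levB 0) (Matrix (Fin N) (Fin N) ℂ)).symm (Pi.single y Z)))) b'‖ ≤ hk' b' y * ‖Z‖)
    {Θ' : ℝ} (hΘ'0 : 0 ≤ Θ')
    (hΘ' : ∀ (bb : Bond (F.P K).d (fun _ => (F.P K).sitesPerDir 0)) (y : PBond (F.P K) k),
      ∑ b', levWeight (F.L : ℝ) ((F.P K).eta k) (bondLevLit F Ω k) 3 bb / levWeight (F.L : ℝ) ((F.P K).eta k) (bondLevLit F Ω k) 1 b' * hk' b' y ≤ Θ')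
    {N₁ : ℝ} (hN₁0 : 0 ≤ N₁)
    (hN₁ : ∀ b', ∑ y, levWeight (F.L : ℝ) ((F.P K).eta k) (bondLevLit F Ω k) 3 b' / levWeight (F.L : ℝ) ((F.P K).eta k) levB 0 y * hk' b' y ≤ N₁)
    (hJ : ‖JOfRecordAtBg F N K k Ω U₀‖ ≤ nJ) :
    letI C₂ : ℝ := 12800000000000000 * (F.L : ℝ) * N
    letI c₄ : ℝ := 1 / (200000000000 * (F.L : ℝ) * N)
    letI r : ℝ := min (c₄ / 4) (min (1 / 2) (1 / (16 * (b * C₂ + 1))))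
    letI R' : ℝ := min r ((1 - 4 * b * C₂ * (r + r)) * (1 / 16))
    letI CV : ℝ := 1024 * (((F.P K).d - 1 : ℕ) : ℝ) * ((1 : ℝ) * 1) ^ 3 * N * (α * (1 : ℝ) ^ 2 + 1 / 16)
        + (((F.P K).d - 1 : ℕ) : ℝ) * ((1 : ℝ) * 1) ^ 3 * (136 + 2 * ((1 : ℝ) * 1)) * N
    letI θ₃ : ℝ := (2 * (1 / (1 - 4 * b * C₂ * (r + r))) + 1) * ΘHw * G / r
    letI θE : ℝ := 2 * ΘHw * G * (1 / (1 - 4 * b * C₂ * (r + r)))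
    letI θE' : ℝ := 2 * Θ' * G * (1 / (1 - 4 * b * C₂ * (r + r)))
    Prop4UniformAtRecord F N K k Ω U₀ levB a hpos hQ r Gp
      ((N * θ₃ * nJ + (N₁ * C₂ * (1 / (1 - 4 * b * C₂ * (r + r))) ^ 2 + N * θE')
        + N * θE * (N₁ * C₂ * (1 / (1 - 4 * b * C₂ * (r + r))) ^ 2) * R'
        + N * (1 + θE * R') * CV * (1 / (1 - 4 * b * C₂ * (r + r))) ^ 2)) R' := by
  have hLN : (0 : ℝ) < (F.L : ℝ) * N := mul_pos Fact.out (by exact_mod_cast Nat.pos_of_ne_zero (NeZero.ne N))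
  have hC₂ : (0 : ℝ) ≤ 12800000000000000 * (F.L : ℝ) * N := by rw [mul_assoc]; positivity
  have hc₄ : (0 : ℝ) < 1 / (200000000000 * (F.L : ℝ) * N) := by rw [mul_assoc]; positivity
  have hr0 := radius_pos hb hC₂ hc₄ one_pos
  exact prop4UniformAtRecord_node00_of_HCol_pos F N K k Ω U₀ levB a hpos hQ Gp hkpos hb hΩ hα0 hα hreg hH
    (prop4LetterColumnsAtRecord_of_kernelLetters F N K k Ω U₀ levB a hpos hQ Gp hH (prop4LetterCAtRecord_of_regular F N k Ω U₀ levB hΩ hα0 hα hreg)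
      (prop4LetterNum_explicit (RV := 1 / 16) hb hC₂ hc₄ (by norm_num)) hr0 hk0 hHk hΘH hH1 hΘHw hHw hgC0 hCg hG0 hG hq hk'0 hNk hΘ'0 hΘ' hN₁0 hN₁) hJ

end Record

end Summit.QuantumFields.YangMills.Theorems.Prop4UniformAtRecord

end
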